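import Mathlib
import HarnessLib
import Summits.HubbardSuperconductivity.HubbardSuperconductivity.Theorems.KLProgrammeC4aTangencyCalculus
import Summits.HubbardSuperconductivity.HubbardSuperconductivity.Theorems.KLProgrammeC4aPartnerBandCooperDefect
import Summits.HubbardSuperconductivity.HubbardSuperconductivity.Theorems.KLProgrammeC4aPartnerBandCritical

/-!
# Route `KLProgramme` — crux C4a, S3 brick (B2, TANGENCY): the anisotropy defect of the co-moving pp loop near the tangency configuration is
# `O(φ² + |e| + |ρ| + |ϑ|)`, uniformly in the base angle

Cell `gate-hubbard-kl`, lane hubbard-kl-c4a-1 (g6); helper for stub (C) `stub_twoLeg_curvature` of the engine-flow child `KLRegimeEngineV17F2`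
(stmt-HubbardSuperconductivity-20437); memo HOME/hubbard-kl-c4a-1/C4A-PLAN.md §24.4 (ii), §24.6 (B2 near (T)).  The pp partner band of the co-moving loop `Φ(e, φ+θ+t)` is
`ē(t) = e_K(S(t) − Φ(e, φ+θ+t))`, `S = pairSumPath μ K ρ ϑ θ`; at the tangency configuration `(ρ,ϑ) = (0,0)` (`S = 2Φ(0,θ+·)`, `R = 2k ∈ 2·FS`) and the loop at the
tangency point `(e,φ) = (0,0)` it vanishes identically in `θ`, with first-order criticality in `φ` and slope `−1` in `e` (`…C4aPartnerBandCritical`).  Here the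
quantitative consequence for the anisotropy defect `𝒜 = ∂_t ē(0)`:

* **`abs_deriv_partnerBand_pp_tangency_le`** — `|𝒜| ≤ C_T(φ)·φ² + (3K₂D₁/d + K₁·RR₁)·(|e| + |ρ|) + (3K₂D₁² + K₁D₂)·|ϑ|`, `C_T(φ) = K₃D₁²(D₁ + |φ|D₂) + K₂D₂(3D₁ + |φ|D₂) + K₁D₃`
  (`D_j = msD A₃ A₄ j`, `d = Dt_min − 2A`, `RR₁ = radialRowOneConst A d`): three reductions — the loop level `e → 0` and the configuration `(ρ,ϑ) → (0,0)` by the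
  argument-curve perturbation lemma `abs_deriv_comp_add_sub_le` with g5's radial rows (`norm_levelPoint_sub_levelPoint_le`, `norm_iteratedDeriv_one_levelPoint_sub_le`,
  `norm_pairDiffPath_zero_le`, `norm_deriv_pairDiffPath_le_rigid`), then the core `abs_deriv_tangency_core_le` on the Fermi curve `Γ = Φ(0,·)` (`e_K ∘ Γ ≡ 0`).

Pure calculus on landed objects; nothing about the model's sizes; nothing asserts superconductivity.  References: FST II CPAM 51 (1998) §3; BGM 2006 §2.4 (2.40) [cite: BenfattoGiulianiMastropietro2006].
-/

noncomputable section

namespace Summit.HubbardSuperconductivity.HubbardSuperconductivity.Theorems.C4a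

set_option linter.dupNamespace false -- summit = problem name (single-conjunct summit), D-0017

open Real Set Filter
open scoped Topology
open Literature.MathematicalPhysics.QuantumLattice Literature.MathematicalPhysics.QuantumLattice.BandSectorCounting Literature.Probability.LatticeModels
open Summit.HubbardSuperconductivity.HubbardSuperconductivity.Theorems.KLRegimeSplit
open Summit.HubbardSuperconductivity.HubbardSuperconductivity.Theorems.DispersionFlow
open Summit.HubbardSuperconductivity.HubbardSuperconductivity.Theorems.PerturbedFermiCurve

section Sizes

variable {K : TrigPolyC4v} {A : ℝ} (hA : ∀ p : Momentum, ∀ j ≤ 2, ‖iteratedFDeriv ℝ j (frameShift K) p‖ ≤ A) (hA20 : A ≤ 1 / 20)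
  (hd : klCurveD ≤ (bandBounds (show (-4 : ℝ) < -1.1 by norm_num) (show (-1.1 : ℝ) ≤ -0.1 by norm_num)
    (show (-0.1 : ℝ) < 0 by norm_num)).Dtmin - 2 * A)
  {μ r : ℝ} (hr : 0 < r) (hlo : (-1.1 : ℝ) < μ - r - A) (hhi : μ + r + A < -0.1)
  {A₃ A₄ : ℝ} (hA₃ : ∀ p : Momentum, ‖iteratedFDeriv ℝ 3 (frameShift K) p‖ ≤ A₃)
  (hA₄ : ∀ p : Momentum, ‖iteratedFDeriv ℝ 4 (frameShift K) p‖ ≤ A₄)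
  {K₁ K₂ K₃ : ℝ} (hK₁ : ∀ p : Momentum, ‖fderiv ℝ (frameLevel μ K) p‖ ≤ K₁) (hK₂ : ∀ p : Momentum, ‖iteratedFDeriv ℝ 2 (frameLevel μ K) p‖ ≤ K₂)
  (hK₃ : ∀ p : Momentum, ‖iteratedFDeriv ℝ 3 (frameLevel μ K) p‖ ≤ K₃)
include hA hA20 hd hr hlo hhi hA₃ hA₄ hK₁ hK₂ hK₃

omit hA20 hr hA₃ hA₄ hK₁ hK₂ hK₃ in
/-- The angular derivative of a tube level curve: `HasDerivAt Φ(x,·) (∂_sΦ(x,s)) s` with `∂_sΦ = iteratedDeriv 1`. -/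
theorem hasDerivAt_levelPoint_angle {x : ℝ} (hx : |x| < r) (s : ℝ) :
    HasDerivAt (levelPoint μ K x) (iteratedDeriv 1 (levelPoint μ K x) s) s := by
  have hADt : 2 * A < (bandBounds (show (-4 : ℝ) < -1.1 by norm_num) (show (-1.1 : ℝ) ≤ -0.1 by norm_num) (show (-0.1 : ℝ) < 0 by norm_num)).Dtmin := by
    have := klCurveD_pos; linarith
  have hC : ContDiff ℝ 4 (levelPoint μ K x) :=
    contDiff_levelPoint_angle (bandBounds (show (-4 : ℝ) < -1.1 by norm_num) (show (-1.1 : ℝ) ≤ -0.1 by norm_num) (show (-0.1 : ℝ) < 0 by norm_num)) hA hADt hlo hhi hx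
  have h := hasDerivAt_iteratedDeriv_of_contDiff_four hC (show 0 < 4 by norm_num) s
  rwa [iteratedDeriv_zero] at h

omit hA20 hA₃ hA₄ hK₁ hK₂ hK₃ in
/-- The t-derivative of the pair-sum path at `t = 0`: `S′(0) = ∂_sΦ(0,θ) + ∂_sΦ(ρ,ϑ+θ)`. -/
theorem hasDerivAt_pairSumPath_zero {ρ : ℝ} (hρ : |ρ| < r) (ϑ θ : ℝ) :
    HasDerivAt (pairSumPath μ K ρ ϑ θ) (iteratedDeriv 1 (levelPoint μ K 0) θ + iteratedDeriv 1 (levelPoint μ K ρ) (ϑ + θ)) 0 := by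
  have h0 : |(0 : ℝ)| < r := by simpa using hr
  have h1 : HasDerivAt (fun t : ℝ => levelPoint μ K 0 (θ + t)) (iteratedDeriv 1 (levelPoint μ K 0) θ) 0 :=
    HasDerivAt.comp_const_add θ 0 (by rw [add_zero]; exact hasDerivAt_levelPoint_angle hA hd hlo hhi h0 θ)
  have h2 : HasDerivAt (fun t : ℝ => levelPoint μ K ρ (ϑ + θ + t)) (iteratedDeriv 1 (levelPoint μ K ρ) (ϑ + θ)) 0 :=
    HasDerivAt.comp_const_add (ϑ + θ) 0 (by rw [add_zero]; exact hasDerivAt_levelPoint_angle hA hd hlo hhi hρ (ϑ + θ))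
  exact h1.add h2

omit hA20 hA₃ hA₄ hK₁ hK₂ hK₃ in
/-- The t-derivative of the pair-difference path at `t = 0`: `D′(0) = ∂_sΦ(0,θ) − ∂_sΦ(ρ,ϑ+θ)`, hence `iteratedDeriv 1 D 0` is that difference. -/
theorem iteratedDeriv_one_pairDiffPath_zero {ρ : ℝ} (hρ : |ρ| < r) (ϑ θ : ℝ) :
    iteratedDeriv 1 (pairDiffPath μ K ρ ϑ θ) 0 = iteratedDeriv 1 (levelPoint μ K 0) θ - iteratedDeriv 1 (levelPoint μ K ρ) (ϑ + θ) := by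
  have h0 : |(0 : ℝ)| < r := by simpa using hr
  have h1 : HasDerivAt (fun t : ℝ => levelPoint μ K 0 (θ + t)) (iteratedDeriv 1 (levelPoint μ K 0) θ) 0 :=
    HasDerivAt.comp_const_add θ 0 (by rw [add_zero]; exact hasDerivAt_levelPoint_angle hA hd hlo hhi h0 θ)
  have h2 : HasDerivAt (fun t : ℝ => levelPoint μ K ρ (ϑ + θ + t)) (iteratedDeriv 1 (levelPoint μ K ρ) (ϑ + θ)) 0 :=
    HasDerivAt.comp_const_add (ϑ + θ) 0 (by rw [add_zero]; exact hasDerivAt_levelPoint_angle hA hd hlo hhi hρ (ϑ + θ))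
  have h : HasDerivAt (pairDiffPath μ K ρ ϑ θ) (iteratedDeriv 1 (levelPoint μ K 0) θ - iteratedDeriv 1 (levelPoint μ K ρ) (ϑ + θ)) 0 := h1.sub h2
  rw [iteratedDeriv_one, h.deriv]

/-- **THE ANISOTROPY DEFECT NEAR TANGENCY**: for every loop level `|e| < r`, loop angle `φ` (relative to the base angle `θ`), and configuration `|ρ| < r`, `ϑ`,
`|∂_t|₀ e_K(S(t) − Φ(e, φ+θ+t))| ≤ C_T(φ)·φ² + (3K₂D₁/d + K₁RR₁)·|e| + (3K₂D₁/d + K₁RR₁)·|ρ| + (3K₂D₁² + K₁D₂)·|ϑ|` — quadratic vanishing in the loop angle at the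
tangency point, linear in the distance to the tangency configuration. -/
theorem abs_deriv_partnerBand_pp_tangency_le {ρ : ℝ} (hρ : |ρ| < r) {e : ℝ} (he : |e| < r) (ϑ θ φ : ℝ) :
    |deriv (fun t : ℝ => frameLevel μ K (pairSumPath μ K ρ ϑ θ t - levelPoint μ K e (φ + θ + t))) 0| ≤
      (K₃ * msD A₃ A₄ 1 ^ 2 * (msD A₃ A₄ 1 + |φ| * msD A₃ A₄ 2) + K₂ * msD A₃ A₄ 2 * (3 * msD A₃ A₄ 1 + |φ| * msD A₃ A₄ 2) + K₁ * msD A₃ A₄ 3) * φ ^ 2 +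
        (3 * K₂ * msD A₃ A₄ 1 / ((bandBounds (show (-4 : ℝ) < -1.1 by norm_num) (show (-1.1 : ℝ) ≤ -0.1 by norm_num) (show (-0.1 : ℝ) < 0 by norm_num)).Dtmin - 2 * A) +
          K₁ * radialRowOneConst A ((bandBounds (show (-4 : ℝ) < -1.1 by norm_num) (show (-1.1 : ℝ) ≤ -0.1 by norm_num) (show (-0.1 : ℝ) < 0 by norm_num)).Dtmin -
            2 * A)) * (|e| + |ρ|) +
        (3 * K₂ * msD A₃ A₄ 1 ^ 2 + K₁ * msD A₃ A₄ 2) * |ϑ| := by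
  set B₀ := bandBounds (show (-4 : ℝ) < -1.1 by norm_num) (show (-1.1 : ℝ) ≤ -0.1 by norm_num) (show (-0.1 : ℝ) < 0 by norm_num) with hB₀
  set dd := B₀.Dtmin - 2 * A with hdd
  have hADt : 2 * A < B₀.Dtmin := by have := klCurveD_pos; linarith
  have hdpos : 0 < dd := by rw [hdd]; linarith
  have h0 : |(0 : ℝ)| < r := by simpa using hr
  have hK₁0 : 0 ≤ K₁ := (norm_nonneg _).trans (hK₁ 0)
  have hK₂0 : 0 ≤ K₂ := (norm_nonneg _).trans (hK₂ 0)
  have hf : ContDiff ℝ 4 (frameLevel μ K) := EngineV8.contDiff_frameLevel μ K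
  have hf2 : ContDiff ℝ 2 (frameLevel μ K) := hf.of_le (by norm_num)
  -- curve data
  have hC : ∀ {x : ℝ}, |x| < r → ContDiff ℝ 4 (levelPoint μ K x) := fun hx => contDiff_levelPoint_angle B₀ hA hADt hlo hhi hx
  have hD : ∀ {x : ℝ}, |x| < r → ∀ {j : ℕ}, 1 ≤ j → j ≤ 4 → ∀ s, ‖iteratedDeriv j (levelPoint μ K x) s‖ ≤ msD A₃ A₄ j := fun hx _ hj1 hj4 s =>
    norm_iteratedDeriv_levelPoint_le hA hA20 hd hlo hhi hA₃ hA₄ hx hj1 hj4 s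
  have hD₁0 : 0 ≤ msD A₃ A₄ 1 := (norm_nonneg _).trans (hD h0 le_rfl (by norm_num) 0)
  have hshiftd : ∀ {x : ℝ} (hx : |x| < r) (α : ℝ), HasDerivAt (fun t : ℝ => levelPoint μ K x (α + t)) (iteratedDeriv 1 (levelPoint μ K x) α) 0 := fun hx α =>
    HasDerivAt.comp_const_add α 0 (by rw [add_zero]; exact hasDerivAt_levelPoint_angle hA hd hlo hhi hx α)
  have hS : ∀ {x : ℝ} (hx : |x| < r) (η : ℝ), HasDerivAt (pairSumPath μ K x η θ)
      (iteratedDeriv 1 (levelPoint μ K 0) θ + iteratedDeriv 1 (levelPoint μ K x) (η + θ)) 0 := fun hx η => hasDerivAt_pairSumPath_zero hA hd hr hlo hhi hx η θ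
  -- the norm of `X′(0)` for `X = S − Φ(x, φ+θ+·)`: at most `3 D₁`
  have hXd : ∀ {x y : ℝ} (hx : |x| < r) (hy : |y| < r) (η : ℝ),
      ‖deriv (fun t : ℝ => pairSumPath μ K x η θ t - levelPoint μ K y (φ + θ + t)) 0‖ ≤ 3 * msD A₃ A₄ 1 := fun {x y} hx hy η => by
    have hXh : HasDerivAt (fun t : ℝ => pairSumPath μ K x η θ t - levelPoint μ K y (φ + θ + t))
        (iteratedDeriv 1 (levelPoint μ K 0) θ + iteratedDeriv 1 (levelPoint μ K x) (η + θ) - iteratedDeriv 1 (levelPoint μ K y) (φ + θ)) 0 :=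
      (hS hx η).sub (hshiftd hy (φ + θ))
    rw [hXh.deriv]
    refine (norm_sub_le _ _).trans ?_
    have := norm_add_le (iteratedDeriv 1 (levelPoint μ K 0) θ) (iteratedDeriv 1 (levelPoint μ K x) (η + θ))
    have := hD h0 le_rfl (by norm_num) θ; have := hD hx le_rfl (by norm_num) (η + θ); have := hD hy le_rfl (by norm_num) (φ + θ)
    linarith
  have hXdiff : ∀ {x y : ℝ} (hx : |x| < r) (hy : |y| < r) (η : ℝ), DifferentiableAt ℝ (fun t : ℝ => pairSumPath μ K x η θ t - levelPoint μ K y (φ + θ + t)) 0 :=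
    fun hx hy η => ((hS hx η).sub (hshiftd hy (φ + θ))).differentiableAt
  -- STEP 1: the loop level `e → 0`
  have step1 : |deriv (fun t : ℝ => frameLevel μ K (pairSumPath μ K ρ ϑ θ t - levelPoint μ K e (φ + θ + t))) 0 -
      deriv (fun t : ℝ => frameLevel μ K (pairSumPath μ K ρ ϑ θ t - levelPoint μ K 0 (φ + θ + t))) 0| ≤
      K₂ * (|e| / dd) * (3 * msD A₃ A₄ 1) + K₁ * (radialRowOneConst A dd * |e|) := by
    have hΔd : HasDerivAt (fun t : ℝ => levelPoint μ K 0 (φ + θ + t) - levelPoint μ K e (φ + θ + t))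
        (iteratedDeriv 1 (levelPoint μ K 0) (φ + θ) - iteratedDeriv 1 (levelPoint μ K e) (φ + θ)) 0 := (hshiftd h0 (φ + θ)).sub (hshiftd he (φ + θ))
    have hfun : (fun t : ℝ => frameLevel μ K (pairSumPath μ K ρ ϑ θ t - levelPoint μ K e (φ + θ + t))) = fun t : ℝ =>
        frameLevel μ K ((fun s : ℝ => pairSumPath μ K ρ ϑ θ s - levelPoint μ K 0 (φ + θ + s)) t +
          (fun s : ℝ => levelPoint μ K 0 (φ + θ + s) - levelPoint μ K e (φ + θ + s)) t) := by
      funext t; beta_reduce; congr 1; abel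
    rw [hfun]
    refine (abs_deriv_comp_add_sub_le hf2 hK₁ hK₂ (hXdiff hρ h0 ϑ) hΔd.differentiableAt).trans ?_
    have hΔ0 : ‖levelPoint μ K 0 (φ + θ + 0) - levelPoint μ K e (φ + θ + 0)‖ ≤ |e| / dd := by
      have h := norm_levelPoint_sub_levelPoint_le B₀ hA hADt hlo hhi (ρ := 0) (ρ' := e) ⟨by linarith, hr⟩ ⟨(abs_lt.1 he).1, (abs_lt.1 he).2⟩ (φ + θ + 0)
      rwa [zero_sub, abs_neg] at h
    have hΔ1 : ‖deriv (fun s : ℝ => levelPoint μ K 0 (φ + θ + s) - levelPoint μ K e (φ + θ + s)) 0‖ ≤ radialRowOneConst A dd * |e| := by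
      rw [hΔd.deriv, ← norm_neg, neg_sub]
      exact norm_iteratedDeriv_one_levelPoint_sub_le hA hd hr hlo hhi he (φ + θ)
    have hX1 := hXd hρ h0 ϑ
    have hP0 : 0 ≤ K₂ * (|e| / dd) := mul_nonneg hK₂0 (div_nonneg (abs_nonneg e) hdpos.le)
    gcongr
  -- STEP 2: the configuration `(ρ, ϑ) → (0, 0)` at loop level `0`
  have step2 : |deriv (fun t : ℝ => frameLevel μ K (pairSumPath μ K ρ ϑ θ t - levelPoint μ K 0 (φ + θ + t))) 0 -
      deriv (fun t : ℝ => frameLevel μ K (pairSumPath μ K 0 0 θ t - levelPoint μ K 0 (φ + θ + t))) 0| ≤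
      K₂ * (|ρ| / dd + msD A₃ A₄ 1 * |ϑ|) * (3 * msD A₃ A₄ 1) + K₁ * (radialRowOneConst A dd * |ρ| + msD A₃ A₄ 2 * |ϑ|) := by
    have hΔd : HasDerivAt (fun t : ℝ => pairSumPath μ K ρ ϑ θ t - pairSumPath μ K 0 0 θ t)
        ((iteratedDeriv 1 (levelPoint μ K 0) θ + iteratedDeriv 1 (levelPoint μ K ρ) (ϑ + θ)) -
          (iteratedDeriv 1 (levelPoint μ K 0) θ + iteratedDeriv 1 (levelPoint μ K 0) (0 + θ))) 0 := (hS hρ ϑ).sub (hS h0 0)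
    have hfun : (fun t : ℝ => frameLevel μ K (pairSumPath μ K ρ ϑ θ t - levelPoint μ K 0 (φ + θ + t))) = fun t : ℝ =>
        frameLevel μ K ((fun s : ℝ => pairSumPath μ K 0 0 θ s - levelPoint μ K 0 (φ + θ + s)) t +
          (fun s : ℝ => pairSumPath μ K ρ ϑ θ s - pairSumPath μ K 0 0 θ s) t) := by
      funext t; beta_reduce; congr 1; abel
    rw [hfun]
    refine (abs_deriv_comp_add_sub_le hf2 hK₁ hK₂ (hXdiff h0 h0 0) hΔd.differentiableAt).trans ?_
    have hΔ0 : ‖pairSumPath μ K ρ ϑ θ 0 - pairSumPath μ K 0 0 θ 0‖ ≤ |ρ| / dd + msD A₃ A₄ 1 * |ϑ| := by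
      have h : pairSumPath μ K ρ ϑ θ 0 - pairSumPath μ K 0 0 θ 0 = -pairDiffPath μ K ρ ϑ θ 0 := by
        simp only [pairSumPath, pairDiffPath, zero_add, add_zero]; abel
      rw [h, norm_neg]
      exact norm_pairDiffPath_zero_le hA hA20 hd hr hlo hhi hA₃ hA₄ hρ ϑ θ
    have hΔ1 : ‖deriv (fun s : ℝ => pairSumPath μ K ρ ϑ θ s - pairSumPath μ K 0 0 θ s) 0‖ ≤ radialRowOneConst A dd * |ρ| + msD A₃ A₄ 2 * |ϑ| := by
      rw [hΔd.deriv, zero_add, show iteratedDeriv 1 (levelPoint μ K 0) θ + iteratedDeriv 1 (levelPoint μ K ρ) (ϑ + θ) -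
          (iteratedDeriv 1 (levelPoint μ K 0) θ + iteratedDeriv 1 (levelPoint μ K 0) θ) =
          -(iteratedDeriv 1 (levelPoint μ K 0) θ - iteratedDeriv 1 (levelPoint μ K ρ) (ϑ + θ)) by abel, norm_neg,
        ← iteratedDeriv_one_pairDiffPath_zero hA hd hr hlo hhi hρ ϑ θ]
      exact norm_deriv_pairDiffPath_le_rigid hA hA20 hd hr hlo hhi hA₃ hA₄ hρ ϑ θ
    have hX1 := hXd h0 h0 0
    have hP0 : 0 ≤ K₂ * (|ρ| / dd + msD A₃ A₄ 1 * |ϑ|) := mul_nonneg hK₂0 (add_nonneg (div_nonneg (abs_nonneg ρ) hdpos.le) (mul_nonneg hD₁0 (abs_nonneg ϑ)))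
    gcongr
  -- STEP 3: the core at the tangency configuration with the loop on the Fermi curve
  have step3 : |deriv (fun t : ℝ => frameLevel μ K (pairSumPath μ K 0 0 θ t - levelPoint μ K 0 (φ + θ + t))) 0| ≤
      (K₃ * msD A₃ A₄ 1 ^ 2 * (msD A₃ A₄ 1 + |φ| * msD A₃ A₄ 2) + K₂ * msD A₃ A₄ 2 * (3 * msD A₃ A₄ 1 + |φ| * msD A₃ A₄ 2) + K₁ * msD A₃ A₄ 3) * φ ^ 2 := by
    have hfun : (fun t : ℝ => frameLevel μ K (pairSumPath μ K 0 0 θ t - levelPoint μ K 0 (φ + θ + t))) = fun t : ℝ =>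
        frameLevel μ K (levelPoint μ K 0 (θ + t) + levelPoint μ K 0 (θ + t) - levelPoint μ K 0 (φ + θ + t)) := by
      funext t; simp only [pairSumPath, zero_add]
    rw [hfun]
    exact abs_deriv_tangency_core_le hf hK₁ hK₂ hK₃ (hC h0) (fun s => frameLevel_levelPoint_zero B₀ hA hr hlo hhi s)
      (fun s => hD h0 le_rfl (by norm_num) s) (fun s => hD h0 (by norm_num) (by norm_num) s) (fun s => hD h0 (by norm_num) (by norm_num) s) θ φ
  -- assemble
  have tri := abs_sub_abs_le_abs_sub (deriv (fun t : ℝ => frameLevel μ K (pairSumPath μ K ρ ϑ θ t - levelPoint μ K e (φ + θ + t))) 0)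
    (deriv (fun t : ℝ => frameLevel μ K (pairSumPath μ K ρ ϑ θ t - levelPoint μ K 0 (φ + θ + t))) 0)
  have tri' := abs_sub_abs_le_abs_sub (deriv (fun t : ℝ => frameLevel μ K (pairSumPath μ K ρ ϑ θ t - levelPoint μ K 0 (φ + θ + t))) 0)
    (deriv (fun t : ℝ => frameLevel μ K (pairSumPath μ K 0 0 θ t - levelPoint μ K 0 (φ + θ + t))) 0)
  have e₁ : K₂ * (|e| / dd) * (3 * msD A₃ A₄ 1) + K₁ * (radialRowOneConst A dd * |e|) = (3 * K₂ * msD A₃ A₄ 1 / dd + K₁ * radialRowOneConst A dd) * |e| := by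
    ring
  have e₂ : K₂ * (|ρ| / dd + msD A₃ A₄ 1 * |ϑ|) * (3 * msD A₃ A₄ 1) + K₁ * (radialRowOneConst A dd * |ρ| + msD A₃ A₄ 2 * |ϑ|) =
      (3 * K₂ * msD A₃ A₄ 1 / dd + K₁ * radialRowOneConst A dd) * |ρ| + (3 * K₂ * msD A₃ A₄ 1 ^ 2 + K₁ * msD A₃ A₄ 2) * |ϑ| := by
    ring
  rw [e₁] at step1
  rw [e₂] at step2
  linarith

end Sizes

end Summit.HubbardSuperconductivity.HubbardSuperconductivity.Theorems.C4a

end
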